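import Summits.NavierStokesRegularity.NavierStokesRegularity.Theorems.FilamentSkeletonRssKelvinGateDivergence

/-!
# Route `FilamentSkeletonRss` · crux `TransverseReductionRJ` (stmt-NavierStokesRegularity-21221) — line `kelvin_gate`,
# stub S2 `PolynomialKelvinGate`: the rotation direction is DIVERGENCE-FREE (it lies in the gate's solenoidal domain)

Helper file (theorems only, `--supports stmt-NavierStokesRegularity-21221 --as helper`).  HONEST FRAMING: bookkeeping
for a HYPOTHETICAL filament-type RSS blow-up route; nothing here bears on Navier–Stokes regularity; no stub is proved.

The gate spec (stub S2) produces divergence-free velocities, so the kernel/cokernel count behind the typed §Rate risk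
(`BaseSpec.lerayLin_rotField`, `GateSpec.one_le_of_approxCokernel`) must be run in the solenoidal class.  This file
checks that the rotation direction belongs to it:

* `divergence_rotField` — for every `C²` field `V`, `div(𝓡V)(y) = −D(div V)(y)[e₃ × y]`
  (`𝓡V = e₃ × V − DV[e₃ × y]`; `tr(J DV) = tr(DV J)` cancels, the rest is the Lie derivative of `div V`);
* `IsDivFree.rotField` — hence `𝓡V` is divergence-free whenever `V` is (`C²`).
-/

set_option linter.dupNamespace false

noncomputable section

namespace Summit.NavierStokesRegularity.NavierStokesRegularity.Theorems.KelvinGate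

open Set Function
open Literature.Analysis.FluidPDE
open scoped InnerProductSpace Topology

/-- **`div(𝓡V) = −D(div V)[e₃ × y]`** for a `C²` field `V`: the infinitesimal rotation commutes with the divergence
(as a Lie derivative along a Killing field). In the standard basis,
`div(𝓡V)(y) = −Σ_k ⟪e_k, D²V(y)[e₃ × y] e_k⟫`. -/
theorem divergence_rotField {V : EuclideanSpace ℝ (Fin 3) → EuclideanSpace ℝ (Fin 3)} (hV : ContDiff ℝ 2 V)
    (y : EuclideanSpace ℝ (Fin 3)) :
    VectorCalculus.divergence
        (fun z => cross (EuclideanSpace.single 2 1) (V z) - fderiv ℝ V z (cross (EuclideanSpace.single 2 1) z)) y =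
      -∑ k : Fin 3, ⟪EuclideanSpace.basisFun (Fin 3) ℝ k,
        fderiv ℝ (fderiv ℝ V) y (cross (EuclideanSpace.single 2 1) y) (EuclideanSpace.basisFun (Fin 3) ℝ k)⟫_ℝ := by
  simp only [cross_single_two_eq_rotGenL]
  have hVd : HasFDerivAt V (fderiv ℝ V y) y := (hV.differentiable (by norm_num) y).hasFDerivAt
  have hPd : HasFDerivAt (fderiv ℝ V) (fderiv ℝ (fderiv ℝ V) y) y :=
    ((hV.fderiv_right (m := 1) (by norm_num)).differentiable (by norm_num) y).hasFDerivAt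
  have hJd : HasFDerivAt (fun z : EuclideanSpace ℝ (Fin 3) => rotGenL z) rotGenL y := rotGenL.hasFDerivAt
  have hRd : HasFDerivAt (fun z => rotGenL (V z) - fderiv ℝ V z (rotGenL z))
      (rotGenL.comp (fderiv ℝ V y) - ((fderiv ℝ V y).comp rotGenL + (fderiv ℝ (fderiv ℝ V) y).flip (rotGenL y))) y :=
    (rotGenL.hasFDerivAt.comp y hVd).sub (hPd.clm_apply hJd)
  have symm2 : ∀ v w, fderiv ℝ (fderiv ℝ V) y v w = fderiv ℝ (fderiv ℝ V) y w v := fun v w =>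
    ((hV.contDiffAt (x := y)).isSymmSndFDerivAt (by simp)).eq v w
  rw [divergence_eq_sum_inner_fderiv (EuclideanSpace.basisFun (Fin 3) ℝ), hRd.fderiv]
  simp only [_root_.sub_apply, _root_.add_apply, ContinuousLinearMap.comp_apply, ContinuousLinearMap.flip_apply,
    inner_sub_right, inner_add_right, Finset.sum_sub_distrib, Finset.sum_add_distrib,
    sum_inner_rotGenL_apply_comm (fderiv ℝ V y), symm2 (EuclideanSpace.basisFun (Fin 3) ℝ _) (rotGenL y)]
  ring

/-- **The infinitesimal rotation of a divergence-free `C²` field is divergence-free.**  So the rotation direction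
`𝓡U⁰_p` of a base family lies in the solenoidal class in which a Kelvin gate operates. -/
theorem IsDivFree.rotField {V : EuclideanSpace ℝ (Fin 3) → EuclideanSpace ℝ (Fin 3)} (hV : ContDiff ℝ 2 V)
    (hdiv : VectorCalculus.IsDivFree V) :
    VectorCalculus.IsDivFree
      (fun z => cross (EuclideanSpace.single 2 1) (V z) - fderiv ℝ V z (cross (EuclideanSpace.single 2 1) z)) := by
  intro y
  rw [divergence_rotField hV y, IsDivFree.sum_inner_fderiv_fderiv_apply hV hdiv y, neg_zero]

end Summit.NavierStokesRegularity.NavierStokesRegularity.Theorems.KelvinGate
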